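import Summits.QuantumFields.YangMills.Theorems.BalabanUVNodesSpineReadingOfRecord13CoPHKRatioDominationBankedChronoOfRecordCeiling
import Summits.QuantumFields.YangMills.Theorems.BalabanUVNodesN20FibreDomCompositionAE

/-!
# N20 (NE7b) ON THE TOWER-FREE ROAD, THE FACE OF RECORD IN THE A.E. CURRENCY: margins `κ₁, E₀` and a coupling ceiling `γ₀ > 0` from the constants, then — for every carrier
# tuple whose histories of record stay in `]0, γ₀]` and obey (2.7) — ONE-COMPONENT relative letters `dV`-ALMOST EVERYWHERE along a removal schedule (each old component removed
# on its OWN fibre at the price of ITS OWN raw factor), the data and labels (b), the multiplicities (ID) and the cut give `RelWeightBound`; NO fibre family, NO boundedness rows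

Cell `pub-ymgap`, YM-PLAN Track A (HUMAN RULING D-0062); seat `pub-ymgap-dag-n20-d` (R134 (a) N20 NE7b s3), gen 44 — director-ym №374 line (E), road [e] TOWER-FREE of record (№377).
`--kind proof --supports stmt-QuantumFields-27366 --as helper` (K3⁸); COUNT-NEUTRAL helper ∕ NOT a discharge; THEOREMS ONLY (0 `def`).  [III] = [Balaban1988Convergent]; [LF-II] = [Balaban1989LargeFieldII];
[IV] = [Balaban1989LargeFieldI].  Companions BY NAME: `…BankedChronoOfRecordCeiling.exists_margins_smallCoupling_relWeightBound_chronoGenealogies_ofRecord` (gen 42, p782644),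
`…N20FibreDomCompositionAE.fibreIntegral_univ_le_of_chainAE` (gen 44: a.e. letters along a chain give def-R's letter on `Finset.univ` at every configuration), and — superseded in
currency, not in content — `…CeilingPerRegion.…_ofRecord_perRegion` (gen 43, p784040: the same face with POINTWISE letters, an enclosing fibre family and boundedness rows).

WHY (a located CURRENCY defect and its repair).  ✓p784040 asks its one-component letters and its boundedness rows AT EVERY configuration `V` on PROPER sub-fibres `fibY Y ⊆ fib s` of the
top lattice — along `dV`-NULL fibres.  The pieces `χ·dressedSlotsOfDatum₉` carry, at every level `≥ 1`, def-B's transport factor `margDensity = rnNN …` (Mathlib's `rnDeriv` VERSION,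
determined `dV`-a.e. only: `T4AveragingDisintegration.margDensity`, `Node00/TStepOfRecord` «VERSION CAVEAT»; the non-determination dag-n13-w2 certified for the (B)-face,
`…N13Cor3MargDensityVersionNotDeterminedAtRecord13`; director-ym №210 class «misstated by inheritance (display currency)»), and the version slot `Revision₁₃` re-chooses the DATUM's
densities, not the dressed slots' transport: a `dV`-a.e.-invariant estimate — the only kind an analytic proof (print's or anyone's) delivers — can discharge neither a POINTWISE letter on a
proper sub-fibre nor a pointwise sup bound.  REPAIR, with no re-run of road [e]: ✓p782644's letter clause has a FREE fibre; at `fib s := Finset.univ` def-R's `∫⌈_{univ} f V` IS the total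
integral (Mathlib `lmarginal_univ`), version-robust, and one-component letters holding `dV`-ALMOST EVERYWHERE on the components' own fibres deliver it by a.e. Fubini on the finite Haar
product (`fibreIntegral_univ_le_of_chainAE`: `lmarginal` a.e.-monotone under `Measure.pi`, composition along the schedule, `lintegral_lmarginal_eq`, and INTEGRABILITY — the displayed
(e1) rows — in place of boundedness).  So the face is restated with (a) := a removal SCHEDULE per bad history (`n s` links `s = u₀ → … → u_{n s}`, the `i`-th link removing the old
component `comp s i` on its fibre `fibY (comp s i)`) and ONE-COMPONENT LETTERS «`∫⌈_{fibY Y}(χ·dr)(u_i) ≤ e^{−credits(G Y)}·e^{+lifeCost(G Y)} · ∫⌈_{fibY Y}(χ·dr)(u_{i+1})` for `dV`-ALMOST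
EVERY configuration, `Y = comp s i`» ([LF-II] p. 387 l. 23–29: (1.79) «for the T-operation connected with an arbitrary large field region» with the improved (1.89), read on [IV] (0.3)'s fibre —
at law level).  GONE against ✓p784040: the enclosing fibre family `fib` with `fibY ⊆ fib s`, and BOTH boundedness rows.  A STRONGER theorem than ✓p784040 (weaker hypotheses, the same
conclusion); ✓p784040 and ✓p782644 stay theorems.

WHAT IS PROVED (kernel; zero `sorry`).  ★★★ `exists_margins_smallCoupling_relWeightBound_chronoGenealogies_ofRecord_perRegionAE` (✓p782644 at `fib s := Finset.univ` ∘
`fibreIntegral_univ_le_of_chainAE` per bad history, the schedule's image as the fibre family, `Finset.prod_image` for the factor clause).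

WHAT STAYS DISPLAYED (NOT PRINTED as theorems of [LF-II] for `d = 4`, NOT proved here): (a′) the ONE-COMPONENT relative letters `dV`-a.e. along the schedules — [LF-II] (1.79)∕(1.89)-improved
KIND read RELATIVELY on [IV] (0.3)'s fibre (junction NC-NE7b-α UNRULED; `pub-balaban`'s R3′) — and the schedules themselves (which old components, in which order, on which fibres, ending
in the good class: DEFINER, with (b)); (b) slot filing into the boxes, genealogy LABELS; (ID) fibre multiplicities `≤ M^{partnerAges}` and caps; (F) slopes, the histories of record in
`]0, γ₀]` and (2.7) at `p₀` up to the level (B14's currency); the cut `j⋆`, `c`; measurability ∕ integrability of the pieces (def-T ∕ K0c shapes; theorems on the live-selector line by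
`…N21ShellSplitOfRecord13CoPHKeyed` §6); `hP : θ.Provisos₁₃CoPH` (K0⁷).

HONEST FRAMING.  [a.e. Fubini + bookkeeping]: one composition; no estimate.  NOTHING of Bałaban's is asserted; NO weight of Bałaban's is bounded; NE7 ∕ NE7b ∕ NE7c NOT PRINTED for
`d = 4` ∕ NOT proved; no `Provisos₁₃CoPH` inhabitant claimed (K0⁷ OPEN); K3⁸ untouched; N20 NOT discharged; counts UNMOVED (typed 28∕28 · discharged 8∕27); one finite four-torus
programme at fixed `ε` — NOT ℝ⁴, NOT OS, NOT a mass gap, NOT the Clay problem.  No `def`, no `instance`, no `notation`, no `sorry`; no decl below carries a cite tag.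
-/

noncomputable section

open MeasureTheory
open scoped BigOperators
open Finset

namespace YMDAG.UVSplit

open Literature.MathematicalPhysics.QuantumFieldTheory.Balaban1983to89
open Literature.MathematicalPhysics.QuantumFieldTheory.Balaban1983to89.T4Continuum
open Literature.MathematicalPhysics.QuantumFieldTheory.Balaban1983to89.Node00
open Literature.MathematicalPhysics.QuantumFieldTheory.Balaban1983to89.B15.BasicStep (fibreIntegral)
open T4WeightBudget (RelWeightBound)
open T4PersistenceDictionary (Gen PEv dictW)
open T4BankedInduction (Banking credits lifeCost)
open T4PartnerMultiplicity (partnerAges)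
open T4BranchingRecordsGas (relabel shape)
open T4PrintedShapeBanking (Consistent)
open T4CanonicalMenus (Chrono fuel canonFam birthMass birthMass_nonneg)

variable {F : T4Family} {N : ℕ} [NeZero N]

/-! ## §1 The face with item (a) := removal schedules + one-component letters `dV`-almost everywhere -/

section PerRegionAE

open scoped Classical in
/-- ★★★ **THE N20 FACE OF RECORD WITH ITEM (a) IN PRINT'S PER-REGION FORM, A.E. CURRENCY** (✓`…_ofRecord` at `fib s := Finset.univ` ∘ `fibreIntegral_univ_le_of_chainAE`): for print's
valid constants `C₀`, `β₀ ≥ 0`, a window exponent `r` with `r(q′+1) < p₀`, ANY `M ≥ 0` and `η̄₊ > 0` there are margins `κ₁, E₀ ≥ 0` with `L^4·e^{η̄₊−κ₁} < 1` and a coupling ceiling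
`γ₀ > 0` — from `(C₀, L, r, β₀, M, η̄₊)`, BEFORE the rank and the carriers — such that for every rank, carrier tuple `(θ, hP, K₀, g₀, os, kr, bd)`, cut, slopes, whenever the histories of
record stay in `]0, γ₀]` and obey (2.7) up to their level, the caps, the displayed measurability ∕ integrability of the pieces and, per `(K, t)`, EACH RUN's removal SCHEDULES with
ONE-COMPONENT LETTERS `dV`-ALMOST EVERYWHERE — link `i` of the bad history `s` removes the old component `Y = comp s i` on its own fibre `fibY Y` at the price of its own raw factor:
`∫⌈_{fibY Y}(χ·dr)(u_i) ≤ e^{−credits(G Y)}·e^{+lifeCost(G Y)}·∫⌈_{fibY Y}(χ·dr)(u_{i+1})` for `dV`-a.e. configuration ([LF-II] p. 387 l. 23–29: (1.79) «for the T-operation connected with an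
arbitrary large field region» with the improved (1.89), read on [IV] (0.3)'s fibre, at law level) —, good images of the schedules' ends, scheduled components filed in `Old` (injective,
non-empty schedules; injective fibre families), data and labels (b), multiplicities (ID) give `RelWeightBound 1 … (K ↦ 1 − exp(−S_K))`, `S_K = birthMass C₀·e^{−κ₁}·ℓ^4·ρ^{K − j⋆(K) + 1}∕(1 − ρ)`,
`ρ = L^4·e^{η̄₊−κ₁}`.  No enclosing fibre family, no boundedness row, no free factor, no factor clause. [bookkeeping] -/
theorem exists_margins_smallCoupling_relWeightBound_chronoGenealogies_ofRecord_perRegionAE {X : Type*} (C₀ : T4PrintedShapeBanking.Consts) (hCv : C₀.Valid) (ha : 0 < C₀.a)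
    (hA : 0 < C₀.A₀) (hμ₀ : 0 < C₀.μ) {r : ℕ} {β₀ : ℝ} (hβ : 0 ≤ β₀) (hrq : r * (C₀.q' + 1) < C₀.p₀) {M ηplus : ℝ} (hM : 0 ≤ M) (hη : 0 < ηplus) :
    ∃ κ₁ E₀ γ₀ : ℝ, 0 ≤ κ₁ ∧ 0 ≤ E₀ ∧ 0 < γ₀ ∧ (F.L : ℝ) ^ 4 * Real.exp (ηplus - κ₁) < 1 ∧
      ∀ {N : ℕ} [NeZero N] (θ : Stage13HParams F N) (hP : θ.Provisos₁₃CoPH F N) (K₀ : ℕ) (g₀ : ℕ → ℝ) (os : List (ULoop F))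
      (kr : ℕ → (Σ K, SiteSeqKey F (K₀ + K)) → (Σ K, SiteSeqKey F (K₀ + K))) (bd : ℕ → (Σ K, SiteSeqKey F (K₀ + K)) → Prop) (c : ℝ), 0 < c →
      ∀ (jstar : ℕ → ℕ), (∀ K, jstar K ≤ K) → (∀ K : ℕ, c * K ≤ ((K - jstar K : ℕ) : ℝ)) →
      ∀ (β' : ℕ → ℝ), (∀ K, 0 ≤ β' K) → 1 + β₀ ≤ (F.L : ℝ) →
        (∀ K, Step.InInterval γ₀ (K₀ + K) (histA₁₃ θ K₀ g₀ K)) → (∀ K, B14.FlowIneq27 (histA₁₃ θ K₀ g₀ K) (β' K) β₀ C₀.p₀ (K₀ + K)) →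
      ∀ (Dcap Ncap : ℕ → ℕ),
      (∀ K t s, Measurable fun V => chiSeqOfRecord F N θ.ν θ.τ9.M (histA₁₃ θ K₀ g₀ K) (K₀ + K) (K₀ + K) s V *
        dressedSlotsOfDatum₉ F N θ.toStage9Params (datumOfRecord₁₃CoPH F N θ hP) g₀ os t (runA₁₃ F K₀ g₀ K) (histA₁₃ θ K₀ g₀ K) (K₀ + K) s V) →
      (∀ K t s, Integrable (fun V => chiSeqOfRecord F N θ.ν θ.τ9.M (histA₁₃ θ K₀ g₀ K) (K₀ + K) (K₀ + K) s V *
        dressedSlotsOfDatum₉ F N θ.toStage9Params (datumOfRecord₁₃CoPH F N θ hP) g₀ os t (runA₁₃ F K₀ g₀ K) (histA₁₃ θ K₀ g₀ K) (K₀ + K) s V)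
        (fieldMeasure (F.P (K₀ + K)) (K₀ + K) (SU N))) →
      (∀ K t s', Measurable fun V => chiSeqOfRecord F N θ.ν θ.τ9.M (histB₁₃ θ K₀ g₀ K) (K₀ + K + 1) (K₀ + K + 1) s' V *
        dressedSlotsOfDatum₉ F N θ.toStage9Params (datumOfRecord₁₃CoPH F N θ hP) g₀ os t (runB₁₃ F K₀ g₀ K) (histB₁₃ θ K₀ g₀ K) (K₀ + K + 1) s' V) →
      (∀ K t s', Integrable (fun V => chiSeqOfRecord F N θ.ν θ.τ9.M (histB₁₃ θ K₀ g₀ K) (K₀ + K + 1) (K₀ + K + 1) s' V *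
        dressedSlotsOfDatum₉ F N θ.toStage9Params (datumOfRecord₁₃CoPH F N θ hP) g₀ os t (runB₁₃ F K₀ g₀ K) (histB₁₃ θ K₀ g₀ K) (K₀ + K + 1) s' V)
        (fieldMeasure (F.P (K₀ + K + 1)) (K₀ + K + 1) (SU N))) →
      (∀ (K : ℕ) (t : ℝ), |t| ≤ 1 →
        ∃ (n : SeqOfRecord F θ.ν θ.τ9.M (histA₁₃ θ K₀ g₀ K) (K₀ + K) (K₀ + K) → ℕ)
          (chain : (s : SeqOfRecord F θ.ν θ.τ9.M (histA₁₃ θ K₀ g₀ K) (K₀ + K) (K₀ + K)) → Fin (n s + 1) → SeqOfRecord F θ.ν θ.τ9.M (histA₁₃ θ K₀ g₀ K) (K₀ + K) (K₀ + K))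
          (comp : (s : SeqOfRecord F θ.ν θ.τ9.M (histA₁₃ θ K₀ g₀ K) (K₀ + K) (K₀ + K)) → Fin (n s) → X)
          (fibY : X → Finset (PBond (F.P (K₀ + K)) (K₀ + K)))
          (Old : SeqOfRecord F θ.ν θ.τ9.M (histA₁₃ θ K₀ g₀ K) (K₀ + K) (K₀ + K) → Finset X)
          (slot : X → (Σ _ : ℕ, (Fin 4 → ℕ))) (G : X → Gen PEv),
          (∀ s, kr K (keyA₁₃ θ K₀ g₀ K s) ∈ badClassK₁₃ θ K₀ g₀ kr bd K t → chain s 0 = s) ∧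
          (∀ s, kr K (keyA₁₃ θ K₀ g₀ K s) ∈ badClassK₁₃ θ K₀ g₀ kr bd K t → ∀ i : Fin (n s), ∀ᵐ V ∂fieldMeasure (F.P (K₀ + K)) (K₀ + K) (SU N),
            fibreIntegral (fibY (comp s i)) (fun V => chiSeqOfRecord F N θ.ν θ.τ9.M (histA₁₃ θ K₀ g₀ K) (K₀ + K) (K₀ + K) (chain s i.castSucc) V *
                dressedSlotsOfDatum₉ F N θ.toStage9Params (datumOfRecord₁₃CoPH F N θ hP) g₀ os t (runA₁₃ F K₀ g₀ K) (histA₁₃ θ K₀ g₀ K) (K₀ + K) (chain s i.castSucc) V) V ≤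
              (Real.exp (-credits (T4PrintedShapeBanking.credit C₀ (fun j => histA₁₃ θ K₀ g₀ K (min j (K₀ + K)))) (G (comp s i))) *
              Real.exp (lifeCost (dictW (fun s => RkOfRecord F.L r (histA₁₃ θ K₀ g₀ K s)) C₀.n₁) (T4PrintedShapeBanking.cost C₀ (K₀ + K) (fun s => RkOfRecord F.L r (histA₁₃ θ K₀ g₀ K s))) (G (comp s i)))) *
              fibreIntegral (fibY (comp s i)) (fun V => chiSeqOfRecord F N θ.ν θ.τ9.M (histA₁₃ θ K₀ g₀ K) (K₀ + K) (K₀ + K) (chain s i.succ) V *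
                dressedSlotsOfDatum₉ F N θ.toStage9Params (datumOfRecord₁₃CoPH F N θ hP) g₀ os t (runA₁₃ F K₀ g₀ K) (histA₁₃ θ K₀ g₀ K) (K₀ + K) (chain s i.succ) V) V) ∧
          (∀ s, kr K (keyA₁₃ θ K₀ g₀ K s) ∈ badClassK₁₃ θ K₀ g₀ kr bd K t → kr K (keyA₁₃ θ K₀ g₀ K (chain s (Fin.last (n s)))) ∉ badClassK₁₃ θ K₀ g₀ kr bd K t) ∧
          (∀ σ s, kr K (keyA₁₃ θ K₀ g₀ K s) ∈ badClassK₁₃ θ K₀ g₀ kr bd K t → chain s (Fin.last (n s)) = σ →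
            (∀ i, comp s i ∈ Old σ) ∧ 0 < n s ∧ Function.Injective (comp s)) ∧
          (∀ σ, Set.InjOn (fun s => (Finset.univ : Finset (Fin (n s))).image (comp s)) {s | kr K (keyA₁₃ θ K₀ g₀ K s) ∈ badClassK₁₃ θ K₀ g₀ kr bd K t ∧ chain s (Fin.last (n s)) = σ}) ∧
          (∀ σ, ∀ Y ∈ Old σ, (slot Y).1 < K₀ + jstar K) ∧
          (∀ σ, ∀ Y ∈ Old σ, (slot Y).2 ∈ Fintype.piFinset fun _ : Fin 4 => Finset.range (2 * F.L ^ F.m * F.L ^ ((K₀ + K) - (slot Y).1))) ∧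
          (∀ σ, ∀ Y ∈ Old σ, Consistent C₀ (K₀ + K) (fun s => RkOfRecord F.L r (histA₁₃ θ K₀ g₀ K s)) (G Y)) ∧
          (∀ σ, ∀ Y ∈ Old σ, (G Y).WF (dictW (fun s => RkOfRecord F.L r (histA₁₃ θ K₀ g₀ K s)) C₀.n₁)) ∧
          (∀ σ, ∀ Y ∈ Old σ, K₀ + K < (G Y).reach (dictW (fun s => RkOfRecord F.L r (histA₁₃ θ K₀ g₀ K s)) C₀.n₁)) ∧ (∀ σ, ∀ Y ∈ Old σ, Chrono PEv.step (G Y)) ∧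
          (∀ σ, ∀ Y ∈ Old σ, ∀ e ∈ (G Y).events, e.kind = 0 → e.fat < Dcap (K₀ + K)) ∧ (∀ σ, ∀ Y ∈ Old σ, fuel (G Y) ≤ Ncap (K₀ + K)) ∧
          (∀ σ, ∀ Y ∈ Old σ, (G Y).rootStep = (slot Y).1) ∧
          (∀ σ, ∀ j < K₀ + jstar K, ∀ zc ∈ (Fintype.piFinset fun _ : Fin 4 => Finset.range (2 * F.L ^ F.m * F.L ^ ((K₀ + K) - j))),
            ∀ G₀ ∈ canonFam Dcap Ncap (K₀ + K) j,
            ((((Old σ).filter fun Y => slot Y = ⟨j, zc⟩ ∧ relabel shape (G Y) = G₀).card : ℕ) : ℝ) ≤ M ^ partnerAges PEv.step G₀)) →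
      (∀ (K : ℕ) (t : ℝ), |t| ≤ 1 →
        ∃ (n : SeqOfRecord F θ.ν θ.τ9.M (histB₁₃ θ K₀ g₀ K) (K₀ + K + 1) (K₀ + K + 1) → ℕ)
          (chain : (s : SeqOfRecord F θ.ν θ.τ9.M (histB₁₃ θ K₀ g₀ K) (K₀ + K + 1) (K₀ + K + 1)) → Fin (n s + 1) → SeqOfRecord F θ.ν θ.τ9.M (histB₁₃ θ K₀ g₀ K) (K₀ + K + 1) (K₀ + K + 1))
          (comp : (s : SeqOfRecord F θ.ν θ.τ9.M (histB₁₃ θ K₀ g₀ K) (K₀ + K + 1) (K₀ + K + 1)) → Fin (n s) → X)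
          (fibY : X → Finset (PBond (F.P (K₀ + K + 1)) (K₀ + K + 1)))
          (Old : SeqOfRecord F θ.ν θ.τ9.M (histB₁₃ θ K₀ g₀ K) (K₀ + K + 1) (K₀ + K + 1) → Finset X)
          (slot : X → (Σ _ : ℕ, (Fin 4 → ℕ))) (G : X → Gen PEv),
          (∀ s', kr K (keyB₁₃ θ K₀ g₀ K s') ∈ badClassK₁₃ θ K₀ g₀ kr bd K t → chain s' 0 = s') ∧
          (∀ s', kr K (keyB₁₃ θ K₀ g₀ K s') ∈ badClassK₁₃ θ K₀ g₀ kr bd K t → ∀ i : Fin (n s'), ∀ᵐ V ∂fieldMeasure (F.P (K₀ + K + 1)) (K₀ + K + 1) (SU N),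
            fibreIntegral (fibY (comp s' i)) (fun V => chiSeqOfRecord F N θ.ν θ.τ9.M (histB₁₃ θ K₀ g₀ K) (K₀ + K + 1) (K₀ + K + 1) (chain s' i.castSucc) V *
                dressedSlotsOfDatum₉ F N θ.toStage9Params (datumOfRecord₁₃CoPH F N θ hP) g₀ os t (runB₁₃ F K₀ g₀ K) (histB₁₃ θ K₀ g₀ K) (K₀ + K + 1) (chain s' i.castSucc) V) V ≤
              (Real.exp (-credits (T4PrintedShapeBanking.credit C₀ (fun j => histB₁₃ θ K₀ g₀ K (min j (K₀ + K + 1)))) (G (comp s' i))) *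
              Real.exp (lifeCost (dictW (fun s => RkOfRecord F.L r (histB₁₃ θ K₀ g₀ K s)) C₀.n₁) (T4PrintedShapeBanking.cost C₀ (K₀ + K + 1) (fun s => RkOfRecord F.L r (histB₁₃ θ K₀ g₀ K s))) (G (comp s' i)))) *
              fibreIntegral (fibY (comp s' i)) (fun V => chiSeqOfRecord F N θ.ν θ.τ9.M (histB₁₃ θ K₀ g₀ K) (K₀ + K + 1) (K₀ + K + 1) (chain s' i.succ) V *
                dressedSlotsOfDatum₉ F N θ.toStage9Params (datumOfRecord₁₃CoPH F N θ hP) g₀ os t (runB₁₃ F K₀ g₀ K) (histB₁₃ θ K₀ g₀ K) (K₀ + K + 1) (chain s' i.succ) V) V) ∧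
          (∀ s', kr K (keyB₁₃ θ K₀ g₀ K s') ∈ badClassK₁₃ θ K₀ g₀ kr bd K t → kr K (keyB₁₃ θ K₀ g₀ K (chain s' (Fin.last (n s')))) ∉ badClassK₁₃ θ K₀ g₀ kr bd K t) ∧
          (∀ σ s', kr K (keyB₁₃ θ K₀ g₀ K s') ∈ badClassK₁₃ θ K₀ g₀ kr bd K t → chain s' (Fin.last (n s')) = σ →
            (∀ i, comp s' i ∈ Old σ) ∧ 0 < n s' ∧ Function.Injective (comp s')) ∧
          (∀ σ, Set.InjOn (fun s' => (Finset.univ : Finset (Fin (n s'))).image (comp s')) {s' | kr K (keyB₁₃ θ K₀ g₀ K s') ∈ badClassK₁₃ θ K₀ g₀ kr bd K t ∧ chain s' (Fin.last (n s')) = σ}) ∧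
          (∀ σ, ∀ Y ∈ Old σ, (slot Y).1 < K₀ + jstar K + 1) ∧
          (∀ σ, ∀ Y ∈ Old σ, (slot Y).2 ∈ Fintype.piFinset fun _ : Fin 4 => Finset.range (2 * F.L ^ F.m * F.L ^ ((K₀ + K + 1) - (slot Y).1))) ∧
          (∀ σ, ∀ Y ∈ Old σ, Consistent C₀ (K₀ + K + 1) (fun s => RkOfRecord F.L r (histB₁₃ θ K₀ g₀ K s)) (G Y)) ∧
          (∀ σ, ∀ Y ∈ Old σ, (G Y).WF (dictW (fun s => RkOfRecord F.L r (histB₁₃ θ K₀ g₀ K s)) C₀.n₁)) ∧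
          (∀ σ, ∀ Y ∈ Old σ, K₀ + K + 1 < (G Y).reach (dictW (fun s => RkOfRecord F.L r (histB₁₃ θ K₀ g₀ K s)) C₀.n₁)) ∧ (∀ σ, ∀ Y ∈ Old σ, Chrono PEv.step (G Y)) ∧
          (∀ σ, ∀ Y ∈ Old σ, ∀ e ∈ (G Y).events, e.kind = 0 → e.fat < Dcap (K₀ + K + 1)) ∧ (∀ σ, ∀ Y ∈ Old σ, fuel (G Y) ≤ Ncap (K₀ + K + 1)) ∧
          (∀ σ, ∀ Y ∈ Old σ, (G Y).rootStep = (slot Y).1) ∧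
          (∀ σ, ∀ j < K₀ + jstar K + 1, ∀ zc ∈ (Fintype.piFinset fun _ : Fin 4 => Finset.range (2 * F.L ^ F.m * F.L ^ ((K₀ + K + 1) - j))),
            ∀ G₀ ∈ canonFam Dcap Ncap (K₀ + K + 1) j,
            ((((Old σ).filter fun Y => slot Y = ⟨j, zc⟩ ∧ relabel shape (G Y) = G₀).card : ℕ) : ℝ) ≤ M ^ partnerAges PEv.step G₀)) →
      RelWeightBound 1 (classSetK₁₃ θ K₀ g₀ kr) (weightAK₁₃ θ hP K₀ g₀ os kr) (weightBK₁₃ θ hP K₀ g₀ os kr) (badClassK₁₃ θ K₀ g₀ kr bd)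
        (fun K => 1 - Real.exp (-(birthMass C₀ * Real.exp (-κ₁) * (((2 * F.L ^ F.m : ℕ) : ℝ) ^ 4) *
          ((((F.L : ℝ) ^ 4) * Real.exp (ηplus - κ₁)) ^ (K - jstar K + 1) / (1 - ((F.L : ℝ) ^ 4) * Real.exp (ηplus - κ₁)))))) := by
  obtain ⟨κ₁, E₀, γ₀, hκ, hE, hγ, hr, hx₀⟩ :=
    exists_margins_smallCoupling_relWeightBound_chronoGenealogies_ofRecord (F := F) (X := X) C₀ hCv ha hA hμ₀ hβ hrq hM hη
  refine ⟨κ₁, E₀, γ₀, hκ, hE, hγ, hr, ?_⟩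
  intro N _ θ hP K₀ g₀ os kr bd c hc jstar hjK hfrac β' hβ' hβL hI h27 Dcap Ncap hmA hintA hmB hintB hLA hLB
  refine hx₀ θ hP K₀ g₀ os kr bd c hc jstar hjK hfrac β' hβ' hβL hI h27 Dcap Ncap hmA hintA hmB hintB ?_ ?_
  · -- run A: the FULL fibre `univ` as the letter's fibre, the schedule's end as the removal map, the product of the scheduled raw factors as the factor, the image as the fibre family
    intro K t ht
    obtain ⟨n, chain, comp, fibY, Old, slot, G, h0, hlink, hgood, hφ, hinj, hslot1, hslot2, hcons, hWF, hreach, hchr, hfat, hfuel, hroot, hID⟩ := hLA K t ht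
    refine ⟨fun s => chain s (Fin.last (n s)), fun _ => Finset.univ,
      fun s => ∏ i : Fin (n s), (Real.exp (-credits (T4PrintedShapeBanking.credit C₀ (fun j => histA₁₃ θ K₀ g₀ K (min j (K₀ + K)))) (G (comp s i))) *
        Real.exp (lifeCost (dictW (fun s => RkOfRecord F.L r (histA₁₃ θ K₀ g₀ K s)) C₀.n₁)
          (T4PrintedShapeBanking.cost C₀ (K₀ + K) (fun s => RkOfRecord F.L r (histA₁₃ θ K₀ g₀ K s))) (G (comp s i)))),
      Old, fun _ s => (Finset.univ : Finset (Fin (n s))).image (comp s), slot, G, ?_, hgood, ?_, hinj, ?_, hslot1, hslot2, hcons, hWF, hreach, hchr, hfat,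
      hfuel, hroot, hID⟩
    · intro s hs V
      have h := fibreIntegral_univ_le_of_chainAE (n s)
        (fun k => fun V => chiSeqOfRecord F N θ.ν θ.τ9.M (histA₁₃ θ K₀ g₀ K) (K₀ + K) (K₀ + K) (chain s k) V *
          dressedSlotsOfDatum₉ F N θ.toStage9Params (datumOfRecord₁₃CoPH F N θ hP) g₀ os t (runA₁₃ F K₀ g₀ K) (histA₁₃ θ K₀ g₀ K) (K₀ + K) (chain s k) V)
        (fun i => fibY (comp s i))
        (fun i => Real.exp (-credits (T4PrintedShapeBanking.credit C₀ (fun j => histA₁₃ θ K₀ g₀ K (min j (K₀ + K)))) (G (comp s i))) *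
          Real.exp (lifeCost (dictW (fun s => RkOfRecord F.L r (histA₁₃ θ K₀ g₀ K s)) C₀.n₁)
            (T4PrintedShapeBanking.cost C₀ (K₀ + K) (fun s => RkOfRecord F.L r (histA₁₃ θ K₀ g₀ K s))) (G (comp s i))))
        (fun k => hmA K t _) (fun k => hintA K t _) (fun i => by positivity) (hlink s hs) V
      rwa [h0 s hs] at h
    · intro σ s hs hrm
      refine ⟨fun Y hY => ?_, ⟨comp s ⟨0, (hφ σ s hs hrm).2.1⟩, Finset.mem_image_of_mem _ (Finset.mem_univ _)⟩⟩
      obtain ⟨i, _, rfl⟩ := Finset.mem_image.1 hY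
      exact (hφ σ s hs hrm).1 i
    · intro σ s hs hrm
      beta_reduce
      rw [Finset.prod_image fun i _ k _ (h : comp s i = comp s k) => (hφ σ s hs hrm).2.2 h]
  · -- run B: the same
    intro K t ht
    obtain ⟨n, chain, comp, fibY, Old, slot, G, h0, hlink, hgood, hφ, hinj, hslot1, hslot2, hcons, hWF, hreach, hchr, hfat, hfuel, hroot, hID⟩ := hLB K t ht
    refine ⟨fun s' => chain s' (Fin.last (n s')), fun _ => Finset.univ,
      fun s' => ∏ i : Fin (n s'), (Real.exp (-credits (T4PrintedShapeBanking.credit C₀ (fun j => histB₁₃ θ K₀ g₀ K (min j (K₀ + K + 1)))) (G (comp s' i))) *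
        Real.exp (lifeCost (dictW (fun s => RkOfRecord F.L r (histB₁₃ θ K₀ g₀ K s)) C₀.n₁)
          (T4PrintedShapeBanking.cost C₀ (K₀ + K + 1) (fun s => RkOfRecord F.L r (histB₁₃ θ K₀ g₀ K s))) (G (comp s' i)))),
      Old, fun _ s' => (Finset.univ : Finset (Fin (n s'))).image (comp s'), slot, G, ?_, hgood, ?_, hinj, ?_, hslot1, hslot2, hcons, hWF, hreach, hchr, hfat,
      hfuel, hroot, hID⟩
    · intro s' hs V
      have h := fibreIntegral_univ_le_of_chainAE (n s')
        (fun k => fun V => chiSeqOfRecord F N θ.ν θ.τ9.M (histB₁₃ θ K₀ g₀ K) (K₀ + K + 1) (K₀ + K + 1) (chain s' k) V *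
          dressedSlotsOfDatum₉ F N θ.toStage9Params (datumOfRecord₁₃CoPH F N θ hP) g₀ os t (runB₁₃ F K₀ g₀ K) (histB₁₃ θ K₀ g₀ K) (K₀ + K + 1) (chain s' k) V)
        (fun i => fibY (comp s' i))
        (fun i => Real.exp (-credits (T4PrintedShapeBanking.credit C₀ (fun j => histB₁₃ θ K₀ g₀ K (min j (K₀ + K + 1)))) (G (comp s' i))) *
          Real.exp (lifeCost (dictW (fun s => RkOfRecord F.L r (histB₁₃ θ K₀ g₀ K s)) C₀.n₁)
            (T4PrintedShapeBanking.cost C₀ (K₀ + K + 1) (fun s => RkOfRecord F.L r (histB₁₃ θ K₀ g₀ K s))) (G (comp s' i))))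
        (fun k => hmB K t _) (fun k => hintB K t _) (fun i => by positivity) (hlink s' hs) V
      rwa [h0 s' hs] at h
    · intro σ s' hs hrm
      refine ⟨fun Y hY => ?_, ⟨comp s' ⟨0, (hφ σ s' hs hrm).2.1⟩, Finset.mem_image_of_mem _ (Finset.mem_univ _)⟩⟩
      obtain ⟨i, _, rfl⟩ := Finset.mem_image.1 hY
      exact (hφ σ s' hs hrm).1 i
    · intro σ s' hs hrm
      beta_reduce
      rw [Finset.prod_image fun i _ k _ (h : comp s' i = comp s' k) => (hφ σ s' hs hrm).2.2 h]

end PerRegionAE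

end YMDAG.UVSplit
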